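import Summits.CriticalPhenomena.CardyFormulaZ2.Theses.CardyWickAnisotropy
import Literature.Probability.Percolation.IsoradialRectangularCrossingsProofs
import Literature.Probability.Percolation.QuadCrossingRotationInvarianceProofs
import Literature.Probability.Percolation.RSW
import Literature.Probability.Percolation.PlanarDuality
import Literature.Probability.Percolation.IsoradialPathCrossing
import Literature.Probability.LatticeModels.ProdBernoulliClusterLocality
import Literature.Probability.RandomPlanarGeometry.KlebanZagierCrossing
import HarnessLib

/-!
# Stub `stub_boxFamilyToZ2QuadLowerBound` of line `birth` of crux `BoxFamilyToCardy`
# (stmt-CriticalPhenomena-14215): DKKMO transfer of Cardy-on-anisotropic-boxes to lower bounds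
# for the Schramm–Smirnov crossing probabilities of `ℤ²` rectangles

Step 2a of the KNOWN half of the crux `AnisotropicBoxCardy → CardyFormulaZ2` (route
`CardyWickAnisotropy`). Given DKKMO Theorem 2.1 (`q = 1`, the named fact
`DKKMO2020_thm21_quadCrossingProb`) and Corollary 1.3 (`dkkmo_crossing_rotation_invariance`) as
hypotheses, Cardy's value along the anisotropic box family (`AnisotropicBoxCardy`: for
`α ∈ (0,π)`, `P_{𝕃(α)}[LR([0,n+1]×[0,n])] → Π_h(cot(α/2))`) gives, for every origin-cornered
rectangle `R = (0,w)×(0,h)` of `ℂ` with left/right crossing sides and every `ε > 0`, a mesh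
scale `c > 0` with `Π_h(w/h) - ε ≤ P_{1/2}[𝒞_{c/n}(R)]` for all large `n`
(`quadCrossingProb`, `Π_h = KlebanZagier.cardyPi`, definitionally the inlined `PiH` of
`AnisotropicBoxCardy`).

Proof (no RSW, no quad → lattice shadowing). Choose `α = 2 arctan(h/w)`, so `cot(α/2) = w/h`, and
the mesh `δ_n = s/n`, `s = h / (2 sin(α/2))`.

* `quadCrossingEmb_of_openCrossing` — the EASY direction of the lattice/continuum dictionary for
  a lattice drawn along an arbitrary embedding `z : ℤ² → ℂ` at mesh `δ`: vertices of `S` drawn in a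
  convex subset of the closed quad, those of `A` on `R.arc 0`, those of `B` (disjoint from `A`) on
  `R.arc 2` ⟹ on lattice configurations `openCrossing S A B ⊆ quadCrossingEmb z R δ` (the
  polyline of an open lattice walk is a continuous path in the closed quad and the open edges).
* `ae_subset_edgeSet_prodBernoulli_isoRectCriticalProb` — `P_{𝕃(α)}`-a.e. configuration is a
  lattice configuration (the canonical weights vanish off `E(ℤ²)`).
* `measureReal_lrCrossing_succ_le_quadCrossingEmb_rotateQuad` — the `𝕃(α)`-box `[0,n]²` drawn by
  `isoRectDrawing α` at mesh `δ` spans exactly the closed rectangle `[0,w]×[0,h]`,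
  `w = 2δn cos(α/2)`, `h = 2δn sin(α/2)`, tilted by `e^{iα/2}` (the quad `rotateQuad (α/2) R`),
  its extreme columns on the tilted left/right sides; with `lrCrossing (n+1) n ⊆ lrCrossing n n`
  (`lrCrossing_anti_left`): `P_{𝕃(α)}[LR([0,n+1]×[0,n])] ≤ P_{𝕃(α)}[𝒞_δ(e^{iα/2}R) on δ𝕃(α)]`.
* `stub_boxFamilyToZ2QuadLowerBound` — assembly: `AnisotropicBoxCardy` at `α` makes the left side
  `> Π_h(w/h) - ε/3` for large `n`; Theorem 2.1 at the fixed quad `T = e^{iα/2}R` (accuracy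
  `min(ε/3, min(α, π-α)/2)`) moves to `P_{𝕃(π/2)}`, which `measureReal_quadCrossingEmb_pi_div_two`
  rewrites as `quadCrossingProb (√2 δ_n) (rotateQuad (-π/4) T)`; `rotateQuad_add` and the exact
  quarter turn `quadCrossingProb_rotateQuad_add_pi_div_two` turn the quad into
  `rotateQuad (α/2 + π/4) R`, `α/2 + π/4 ∈ (π/4, 3π/4)`, and Corollary 1.3 at `R` (accuracy
  `min(ε/3, π/8)`) removes the tilt; `c = √2 s`.
-/

noncomputable section

open MeasureTheory Filter Topology Set
open Literature.Probability.RandomPlanarGeometry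
open Literature.Probability.Percolation (DKKMO2020_thm21_quadCrossingProb
  dkkmo_crossing_rotation_invariance quadCrossingProb)
open Literature.Probability.Percolation
open Literature.Probability.LatticeModels
open Literature.Probability.RandomPlanarGeometry.KlebanZagier (cardyPi)
open Summit.CriticalPhenomena.CardyFormulaZ2.Theses.CardyWickAnisotropy (AnisotropicBoxCardy)

namespace Summit.CriticalPhenomena.CardyFormulaZ2.Cruxes.BoxFamilyToCardy.Birth

/-! ### The easy direction: open lattice crossings drawn in a quad cross the quad -/

/-- **An open lattice crossing drawn inside a quad is a Schramm–Smirnov crossing** (easy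
direction of the lattice/continuum dictionary, for a lattice drawn along any embedding `z` at
mesh `δ`). If the vertices of `S` are drawn in a convex set `C ⊆ closure R.carrier`, those of `A`
on `R.arc 0`, those of `B` on `R.arc 2`, and `A`, `B` are disjoint, then for a lattice
configuration `ω ⊆ E(ℤ²)` an open crossing `ω ∈ openCrossing S A B` gives
`ω ∈ quadCrossingEmb z R δ`: the polyline of an open walk of `ℤ²` inside `S` from `A` to `B` is a
continuous path in `C ∩ openEdgeUnionEmb z δ ω` from a point of `R.arc 0` to a point of
`R.arc 2`. [folklore] -/
theorem quadCrossingEmb_of_openCrossing (z : Site 2 → ℂ) (δ : ℝ) (R : ConformalRectangle)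
    {C : Set ℂ} (hC : Convex ℝ C) (hCR : C ⊆ closure R.carrier)
    {S A B : Set (Site 2)} (hS : ∀ v ∈ S, (δ : ℂ) * z v ∈ C)
    (hA : ∀ v ∈ A, (δ : ℂ) * z v ∈ R.arc 0) (hB : ∀ v ∈ B, (δ : ℂ) * z v ∈ R.arc 2)
    (hAB : Disjoint A B) {ω : BondConfig (Site 2)} (hω : ω ⊆ (zdGraph 2).edgeSet)
    (h : ω ∈ openCrossing S A B) : ω ∈ quadCrossingEmb z R δ := by
  obtain ⟨x, hx, y, hy, hxy⟩ := h
  obtain ⟨W, hWs, hWe⟩ := exists_walk_of_mem_openConnIn hω hxy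
  have hne : x ≠ y := by
    rintro rfl
    exact Set.disjoint_left.1 hAB hx hy
  have hnil : ¬ W.Nil := fun hn => hne hn.eq
  set f : Site 2 → ℂ := fun v => (δ : ℂ) * z v with hf
  set γ := W.toCurve f with hγ
  have hγO : range γ ⊆ openEdgeUnionEmb z δ ω := by
    refine (range_toCurve_subset_iUnion f hnil).trans ?_
    intro p hp
    simp only [mem_iUnion] at hp
    obtain ⟨d, hd, hp⟩ := hp
    exact mem_openEdgeUnionEmb_iff.2 ⟨d.fst, d.snd, d.adj, hWe _ (List.mem_map.2 ⟨d, hd, rfl⟩), hp⟩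
  have hγC : range γ ⊆ C := range_toCurve_subset_of_convex f W hC fun v hv => hS v (hWs v hv)
  have h0 : γ 0 = f x := SimpleGraph.Walk.toCurve_apply_zero f W
  have h1 : γ 1 = f y := toCurve_one f W
  exact ⟨f x, hA x hx, f y, hB y hy, ⟨γ, h0, h1⟩, fun t => ⟨hCR (hγC ⟨t, rfl⟩), hγO ⟨t, rfl⟩⟩⟩

/-- **`P_{𝕃(α)}` is carried by lattice configurations**: the canonical weights
`isoRectCriticalProb α` vanish off the edge set of `ℤ²`, so almost surely `ω ⊆ E(ℤ²)`.
[folklore] -/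
theorem ae_subset_edgeSet_prodBernoulli_isoRectCriticalProb (α : ℝ) :
    ∀ᵐ ω ∂(prodBernoulli (isoRectCriticalProb α)), ω ⊆ (zdGraph 2).edgeSet := by
  have h := prodBernoulli_ae_forall_notMem (isoRectCriticalProb α)
    (Z := ((zdGraph 2).edgeSet : Set (Sym2 (Site 2)))ᶜ) (Set.to_countable _) (fun e he => by
      unfold isoRectCriticalProb
      rw [if_neg (show e ∉ (zdGraph 2).edgeSet from he)])
  filter_upwards [h] with ω hω e he
  by_contra hne
  exact hω e hne he

/-- **The `𝕃(α)`-box `[0,n]²` at mesh `δ` is the tilted rectangle; box crossings cross the tilted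
quad.** Let `α ∈ (0,π)`, `δ > 0`, `n ≥ 1`, `w = 2δn cos(α/2)`, `h = 2δn sin(α/2)`, and let the
conformal rectangle `R` have carrier `(0,w)×(0,h)`, side `R.arc 0` the left side `{0}×[0,h]` and
side `R.arc 2` the right side `{w}×[0,h]`. The vertex `v ∈ [0,n]²` of `ℤ²` is drawn by
`δ · isoRectDrawing α` at `e^{iα/2}(2δ cos(α/2) v₀ + 2δ sin(α/2) v₁ i) ∈ e^{iα/2} [0,w]×[0,h]`, the
closed carrier of the tilted quad `rotateQuad (α/2) R`, the columns `v₀ = 0`, `v₀ = n` landing on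
its sides `0`, `2`; hence (with `lrCrossing (n+1) n ⊆ lrCrossing n n` on lattice configurations,
`lrCrossing_anti_left`, and `quadCrossingEmb_of_openCrossing`)
`P_{𝕃(α)}[LR([0,n+1]×[0,n])] ≤ P_{𝕃(α)}[𝒞_δ(e^{iα/2} R) on δ𝕃(α)]`. [folklore] -/
theorem measureReal_lrCrossing_succ_le_quadCrossingEmb_rotateQuad {α δ w h : ℝ}
    (hα : α ∈ Ioo 0 Real.pi) (hδ : 0 < δ) {n : ℕ} (hn : 1 ≤ n)
    (hw : δ * (2 * Real.cos (α / 2)) * n = w) (hh : δ * (2 * Real.sin (α / 2)) * n = h)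
    (R : ConformalRectangle) (hcar : R.carrier = Ioo (0:ℝ) w ×ℂ Ioo (0:ℝ) h)
    (h0 : R.arc 0 = {z : ℂ | z.re = 0 ∧ z.im ∈ Icc (0:ℝ) h})
    (h2 : R.arc 2 = {z : ℂ | z.re = w ∧ z.im ∈ Icc (0:ℝ) h}) :
    (prodBernoulli (isoRectCriticalProb α)).real (lrCrossing (n + 1) n) ≤
      (prodBernoulli (isoRectCriticalProb α)).real
        (quadCrossingEmb (isoRectDrawing α) (rotateQuad (α / 2) R) δ) := by
  -- positivity of the side lengths
  have hcos : 0 < Real.cos (α / 2) :=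
    Real.cos_pos_of_mem_Ioo ⟨by linarith [hα.1, Real.pi_pos], by linarith [hα.2]⟩
  have hsin : 0 < Real.sin (α / 2) :=
    Real.sin_pos_of_pos_of_lt_pi (by linarith [hα.1]) (by linarith [hα.2, Real.pi_pos])
  have hn' : (1 : ℝ) ≤ n := by exact_mod_cast hn
  have hw0 : 0 < w := by rw [← hw]; positivity
  have hh0 : 0 < h := by rw [← hh]; positivity
  -- the rotation and the drawn points
  set ρ : ℂ ≃ₜ ℂ := (rotation (Circle.exp (α / 2))).toHomeomorph with hρ
  have hρfun : (fun u : ℂ => rotation (Circle.exp (α / 2)) u) = ρ := by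
    funext u; rw [hρ, LinearIsometryEquiv.coe_toHomeomorph]
  have hρapp : ∀ u : ℂ, ρ u = Complex.exp (((α / 2 : ℝ) : ℂ) * Complex.I) * u := fun u => by
    rw [hρ, LinearIsometryEquiv.coe_toHomeomorph, rotation_apply, Circle.coe_exp]
  have hdraw : ∀ v : Site 2, (δ : ℂ) * isoRectDrawing α v = ρ ((δ : ℂ) * isoRectEmbedding α v) :=
    fun v => by rw [hρapp, isoRectDrawing]; ring
  have hre : ∀ v : Site 2, ((δ : ℂ) * isoRectEmbedding α v).re = δ * (2 * Real.cos (α / 2)) * v 0 :=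
    fun v => by rw [Complex.re_ofReal_mul, isoRectEmbedding_re]; ring
  have him : ∀ v : Site 2, ((δ : ℂ) * isoRectEmbedding α v).im = δ * (2 * Real.sin (α / 2)) * v 1 :=
    fun v => by rw [Complex.im_ofReal_mul, isoRectEmbedding_im]; ring
  -- the closed tilted quad and its sides
  have hclR : closure R.carrier = Icc (0:ℝ) w ×ℂ Icc (0:ℝ) h := by
    rw [hcar, Complex.closure_reProdIm, closure_Ioo hw0.ne, closure_Ioo hh0.ne]
  have hclT : closure (rotateQuad (α / 2) R).carrier = ρ '' (Icc (0:ℝ) w ×ℂ Icc (0:ℝ) h) := by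
    rw [← hclR, Homeomorph.image_closure]
    rfl
  have harc0 : (rotateQuad (α / 2) R).arc 0 = ρ '' {z : ℂ | z.re = 0 ∧ z.im ∈ Icc (0:ℝ) h} := by
    rw [arc_rotateQuad, hρfun, h0]
  have harc2 : (rotateQuad (α / 2) R).arc 2 = ρ '' {z : ℂ | z.re = w ∧ z.im ∈ Icc (0:ℝ) h} := by
    rw [arc_rotateQuad, hρfun, h2]
  -- convexity of the closed tilted quad
  have hconvR : Convex ℝ (Icc (0:ℝ) w ×ℂ Icc (0:ℝ) h) := by
    rw [← convexHull_eq_self, Complex.convexHull_reProdIm, (convex_Icc _ _).convexHull_eq,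
      (convex_Icc _ _).convexHull_eq]
  have hconvT : Convex ℝ (closure (rotateQuad (α / 2) R).carrier) := by
    rw [hclT]
    refine hconvR.is_linear_image (f := fun u => ρ u) ⟨fun x y => ?_, fun c x => ?_⟩
    · rw [hρapp, hρapp, hρapp]; ring
    · rw [hρapp, hρapp, Complex.real_smul, Complex.real_smul]; ring
  -- coordinates of box points
  have hbox : ∀ v : Site 2, v ∈ (rectangle n n : Set (Site 2)) →
      (δ : ℂ) * isoRectEmbedding α v ∈ Icc (0:ℝ) w ×ℂ Icc (0:ℝ) h := by
    intro v hv
    rw [Finset.mem_coe, mem_rectangle_iff] at hv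
    obtain ⟨hv0, hv0', hv1, hv1'⟩ := hv
    have e0 : (0 : ℝ) ≤ v 0 := by exact_mod_cast hv0
    have e0' : ((v 0 : ℤ) : ℝ) ≤ n := by exact_mod_cast hv0'
    have e1 : (0 : ℝ) ≤ v 1 := by exact_mod_cast hv1
    have e1' : ((v 1 : ℤ) : ℝ) ≤ n := by exact_mod_cast hv1'
    rw [Complex.mem_reProdIm, hre, him]
    refine ⟨⟨by positivity, ?_⟩, ⟨by positivity, ?_⟩⟩
    · rw [← hw]; exact mul_le_mul_of_nonneg_left e0' (by positivity)
    · rw [← hh]; exact mul_le_mul_of_nonneg_left e1' (by positivity)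
  -- the inclusion on lattice configurations, then integrate
  refine ENNReal.toReal_mono (measure_ne_top _ _) (measure_mono_ae ?_)
  filter_upwards [ae_subset_edgeSet_prodBernoulli_isoRectCriticalProb α] with ω hω hc
  have hc' : ω ∈ lrCrossing n n := lrCrossing_anti_left (Nat.le_succ n) n hω hc
  refine quadCrossingEmb_of_openCrossing (isoRectDrawing α) δ (rotateQuad (α / 2) R) hconvT
    subset_rfl (S := (rectangle n n : Set (Site 2))) (A := (leftSide n n : Set (Site 2)))
    (B := (rightSide n n : Set (Site 2))) ?_ ?_ ?_ ?_ hω hc'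
  · intro v hv
    rw [hclT, hdraw]
    exact mem_image_of_mem _ (hbox v hv)
  · intro v hv
    rw [Finset.mem_coe, leftSide, Finset.mem_filter] at hv
    rw [harc0, hdraw]
    refine mem_image_of_mem _ ⟨?_, (Complex.mem_reProdIm.1 (hbox v (Finset.mem_coe.2 hv.1))).2⟩
    rw [hre, hv.2]; push_cast; ring
  · intro v hv
    rw [Finset.mem_coe, rightSide, Finset.mem_filter] at hv
    rw [harc2, hdraw]
    refine mem_image_of_mem _ ⟨?_, (Complex.mem_reProdIm.1 (hbox v (Finset.mem_coe.2 hv.1))).2⟩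
    rw [hre, hv.2, ← hw]; push_cast; ring
  · rw [Finset.disjoint_coe, Finset.disjoint_left]
    intro v hvA hvB
    rw [leftSide, Finset.mem_filter] at hvA
    rw [rightSide, Finset.mem_filter] at hvB
    have : (n : ℤ) = 0 := by rw [← hvB.2, hvA.2]
    omega

/-! ### The stub: assembly -/

/-- **Stub 2a of line `birth` of crux `BoxFamilyToCardy` — DKKMO transfer of the box family to
the square lattice, lower bounds only.** Given DKKMO Theorem 2.1 (`q = 1`) and Corollary 1.3 as
hypotheses, Cardy along the anisotropic box family implies: for every origin-cornered
axis-parallel rectangle `R = (0,w)×(0,h)` whose crossing sides are its left and right sides and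
every `ε > 0` there is a mesh scale `c > 0` with `Π_h(w/h) - ε ≤ P_{1/2}[𝒞_{c/n}(R)]` for all
large `n`. With `cot(α/2) = w/h`, `s = h/(2 sin(α/2))`, `δ_n = s/n`, `c = √2 s`:
`Π_h(w/h) - ε/3 < P_{𝕃(α)}[LR([0,n+1]×[0,n])]` (`AnisotropicBoxCardy`)
`≤ P_{𝕃(α)}[𝒞_{δ_n}(e^{iα/2}R)]` (`measureReal_lrCrossing_succ_le_quadCrossingEmb_rotateQuad`)
`≤ P_{𝕃(π/2)}[𝒞_{δ_n}(e^{iα/2}R)] + ε/3` (Theorem 2.1 at the fixed tilted quad)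
`= P_{1/2}[𝒞_{√2 δ_n}(e^{i(α/2-π/4)}R)] + ε/3` (`measureReal_quadCrossingEmb_pi_div_two`,
`rotateQuad_add`) `= P_{1/2}[𝒞_{√2 δ_n}(e^{i(α/2+π/4)}R)] + ε/3` (exact quarter turn)
`≤ P_{1/2}[𝒞_{√2 δ_n}(R)] + 2ε/3` (Corollary 1.3, `α/2 + π/4 ∈ (π/4, 3π/4)`).
[cite: DKKMO2020Rotational, Thm 2.1 and Cor. 1.3 (q = 1)] -/
theorem stub_boxFamilyToZ2QuadLowerBound :
    DKKMO2020_thm21_quadCrossingProb → dkkmo_crossing_rotation_invariance → AnisotropicBoxCardy →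
      ∀ (R : ConformalRectangle) (w h : ℝ), 0 < w → 0 < h →
        R.carrier = Set.Ioo (0:ℝ) w ×ℂ Set.Ioo (0:ℝ) h →
        R.arc 0 = {z : ℂ | z.re = 0 ∧ z.im ∈ Set.Icc (0:ℝ) h} →
        R.arc 2 = {z : ℂ | z.re = w ∧ z.im ∈ Set.Icc (0:ℝ) h} →
        ∀ ε : ℝ, 0 < ε → ∃ c : ℝ, 0 < c ∧ ∃ n₀ : ℕ, ∀ n : ℕ, n₀ ≤ n →
          cardyPi (w / h) - ε ≤ quadCrossingProb (c / n) R := by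
  intro h21 hrot hA R w h hw hh hcar h0 h2 ε hε
  -- the angle `α ∈ (0, π)` with `cot (α/2) = w/h`
  obtain ⟨α, hαmem, hcot⟩ : ∃ α : ℝ, α ∈ Set.Ioo (0:ℝ) Real.pi ∧
      Real.cos (α / 2) / Real.sin (α / 2) = w / h := by
    refine ⟨2 * Real.arctan (h / w), ⟨?_, ?_⟩, ?_⟩
    · have := Real.arctan_pos.2 (div_pos hh hw); linarith
    · have := Real.arctan_lt_pi_div_two (h / w); linarith
    · have e : 2 * Real.arctan (h / w) / 2 = Real.arctan (h / w) := by ring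
      have hc : 0 < Real.cos (Real.arctan (h / w)) := Real.cos_arctan_pos _
      have ht : Real.sin (Real.arctan (h / w)) / Real.cos (Real.arctan (h / w)) = h / w := by
        rw [← Real.tan_eq_sin_div_cos, Real.tan_arctan]
      rw [e]
      rw [div_eq_div_iff hc.ne' hw.ne'] at ht
      have hs : 0 < Real.sin (Real.arctan (h / w)) := by
        have : 0 < h * Real.cos (Real.arctan (h / w)) := mul_pos hh hc
        nlinarith
      rw [div_eq_div_iff hs.ne' hh.ne']
      linarith
  have hcos : 0 < Real.cos (α / 2) :=
    Real.cos_pos_of_mem_Ioo ⟨by linarith [hαmem.1, Real.pi_pos], by linarith [hαmem.2]⟩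
  have hsin : 0 < Real.sin (α / 2) :=
    Real.sin_pos_of_pos_of_lt_pi (by linarith [hαmem.1]) (by linarith [hαmem.2, Real.pi_pos])
  -- Cardy along the box family at the angle `α`
  have hA' : Tendsto (fun n : ℕ ↦ (prodBernoulli (isoRectCriticalProb α)).real
      (lrCrossing (n + 1) n)) atTop (𝓝 (cardyPi (Real.cos (α / 2) / Real.sin (α / 2)))) :=
    hA α hαmem
  rw [hcot] at hA'
  -- the mesh scale `s / n` and the tilted quad `T = e^{iα/2} R`
  set s : ℝ := h / (2 * Real.sin (α / 2)) with hs
  have hs0 : 0 < s := by positivity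
  have hsh : s * (2 * Real.sin (α / 2)) = h := by
    rw [hs]; field_simp
  have hsw : s * (2 * Real.cos (α / 2)) = w := by
    rw [div_eq_div_iff hsin.ne' hh.ne'] at hcot
    rw [hs]
    field_simp
    linarith
  set T : ConformalRectangle := rotateQuad (α / 2) R with hT
  -- DKKMO Theorem 2.1 at the fixed quad `T`
  set η : ℝ := min (ε / 3) (min α (Real.pi - α) / 2) with hη
  have hη0 : 0 < η := lt_min (by linarith) (by
    have := lt_min hαmem.1 (sub_pos.2 hαmem.2); linarith)
  have hηε : η ≤ ε / 3 := min_le_left _ _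
  have hαη : α ∈ Set.Ioo η (Real.pi - η) := by
    have h1 : η ≤ min α (Real.pi - α) / 2 := min_le_right _ _
    have h2 : min α (Real.pi - α) ≤ α := min_le_left _ _
    have h3 : min α (Real.pi - α) ≤ Real.pi - α := min_le_right _ _
    constructor <;> linarith [hαmem.1, hαmem.2]
  obtain ⟨δ₀, hδ₀, H21⟩ := h21 T η hη0
  -- DKKMO Corollary 1.3 at the quad `R`
  set η' : ℝ := min (ε / 3) (Real.pi / 8) with hη'
  have hη'0 : 0 < η' := lt_min (by linarith) (by positivity)
  have hη'ε : η' ≤ ε / 3 := min_le_left _ _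
  have hη'π : η' ≤ Real.pi / 8 := min_le_right _ _
  obtain ⟨δ₁, hδ₁, Hrot⟩ := hrot R η' hη'0
  -- eventually in `n`
  have e1 : ∀ᶠ n : ℕ in atTop, cardyPi (w / h) - ε / 3 <
      (prodBernoulli (isoRectCriticalProb α)).real (lrCrossing (n + 1) n) :=
    hA'.eventually_const_lt (by linarith)
  have e2 : ∀ᶠ n : ℕ in atTop, s / (n : ℝ) < δ₀ :=
    (tendsto_const_div_atTop_nhds_zero_nat s).eventually_lt_const hδ₀
  have e3 : ∀ᶠ n : ℕ in atTop, Real.sqrt 2 * s / (n : ℝ) < δ₁ :=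
    (tendsto_const_div_atTop_nhds_zero_nat (Real.sqrt 2 * s)).eventually_lt_const hδ₁
  have e4 : ∀ᶠ n : ℕ in atTop, 1 ≤ n := eventually_ge_atTop 1
  obtain ⟨n₀, hn₀⟩ := Filter.eventually_atTop.1 ((e1.and e2).and (e3.and e4))
  refine ⟨Real.sqrt 2 * s, by positivity, n₀, fun n hn => ?_⟩
  obtain ⟨⟨hn1, hn2⟩, hn3, hn4⟩ := hn₀ n hn
  have hnpos : (0 : ℝ) < n := by exact_mod_cast hn4
  have hdpos : 0 < s / n := div_pos hs0 hnpos
  -- (ii) box crossings of `[0,n+1]×[0,n]` cross the tilted quad at mesh `s / n`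
  have hstep2 : (prodBernoulli (isoRectCriticalProb α)).real (lrCrossing (n + 1) n) ≤
      (prodBernoulli (isoRectCriticalProb α)).real (quadCrossingEmb (isoRectDrawing α) T (s / n)) :=
    measureReal_lrCrossing_succ_le_quadCrossingEmb_rotateQuad hαmem hdpos hn4
      (by rw [← hsw]; field_simp) (by rw [← hsh]; field_simp) R hcar h0 h2
  -- (iii) Theorem 2.1 moves to `𝕃(π/2) = e^{iπ/4} √2 ℤ²`
  have hstep3 := H21 α hαη (s / n) ⟨hdpos, hn2⟩
  rw [measureReal_quadCrossingEmb_pi_div_two T (s / n), abs_sub_le_iff] at hstep3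
  -- (iv)+(v) untilt: `e^{-iπ/4} T = e^{i(α/2 - π/4)} R`, quarter turn, Cor. 1.3
  have hrot4 : rotateQuad (-(Real.pi / 4)) T = rotateQuad (α / 2 + -(Real.pi / 4)) R :=
    (rotateQuad_add _ _ _).symm
  have hquarter : quadCrossingProb (Real.sqrt 2 * (s / n)) (rotateQuad (α / 2 + -(Real.pi / 4)) R) =
      quadCrossingProb (Real.sqrt 2 * (s / n))
        (rotateQuad (α / 2 + -(Real.pi / 4) + Real.pi / 2) R) :=
    (quadCrossingProb_rotateQuad_add_pi_div_two _ _ R).symm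
  have hβ : α / 2 + -(Real.pi / 4) + Real.pi / 2 ∈ Set.Ioo η' (Real.pi - η') := by
    constructor <;> nlinarith [hαmem.1, hαmem.2, Real.pi_pos, hη'π]
  have hstep5 := Hrot _ hβ (Real.sqrt 2 * (s / n)) ⟨by positivity, by rwa [← mul_div_assoc]⟩
  rw [abs_sub_le_iff] at hstep5
  rw [hrot4, hquarter] at hstep3
  rw [mul_div_assoc]
  linarith [hstep3.1, hstep5.1]

end Summit.CriticalPhenomena.CardyFormulaZ2.Cruxes.BoxFamilyToCardy.Birth

end
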